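import Summits.QuantumFields.BalabanUV.Beta.FP.SliceReciprocalChain
import Summits.QuantumFields.BalabanUV.Beta.FP.PerfectPropagatorBound
import Mathlib.Analysis.SpecialFunctions.Trigonometric.Bounds

/-!
# `BalabanUV.Beta.FP.DispersionSliceChain` — road «FP» for binder row D1, leaf H2-P, row H2-P-B (the SCALAR factor of `B`): the coordinate-slice chain of
# `(2ε(s))⁻¹ = ‖p̂(s)‖⁻²` along `s(t) = i.insertNth t q` — `f(t) := 2ε(s(t)) = (2 − 2cos t) + 2ε(q)`, `f′ = 2 sin t`, `f″ = 2 cos t`, `f‴ = −2 sin t`, the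
# reciprocal chain `rc0…rc3` of `FP/SliceReciprocalChain` instantiated, and on the zone (`q ∈ BZ d`, `q ≠ 0`) the graded letters `|(1∕f)^{(k)}(t)| ≤ C_k∕‖s(t)‖^{2+k}`

HONEST DEPENDENCY (page 1, mandatory): continuum YM on T⁴ ⇐ BetaPertH ∧ nine spine estimates (0/9 proved); BetaPertH ⇐ (D1) ∧ (D4) ∧ CAP+tail;
G-an2-4 gates asym, D1 and NE2/3/4.  HONEST FRAMING (cell contract, verbatim): «discharging `BetaPertH` makes Bałaban's UV stability UNCONDITIONAL —
a real constructive-QFT result; it is NOT the continuum limit and NOT the Clay problem.»  THIS MODULE DISCHARGES NOTHING of the wall: [folklore] trigonometric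
calculus (Mathlib) + Jordan's inequality (`LatticeGreenFunction.mul_norm_sq_le_dispersion`) fed into `FP/SliceReciprocalChain`.  Four data defs (`fD`, `fD1`, `fD2`, `fD3`
— the slice of `2ε` and its three derivatives, [our object] names); no `def … : Prop`; nothing cited as a hypothesis; 0 sorry; 0 wall binders; NOT D1, NOT BetaPertH,
NOT continuum, NOT Clay.

ABSOLUTE RULE (cell charter, verbatim): «No internally-minted statement may enter as a cited fact. Every hypothesis is either kernel-proved in this package or a
verbatim quotation of a PUBLISHED theorem with page reference. The manuscript(s) under audit are NOT citable for their own disputed steps — they are the thing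
under adjudication; programme-internal (2001/route/tribunal) claims are never citable.»

WHAT (lattice dimension `d + 1`, coordinate `i`, transverse momentum `q : Fin d → ℝ`, slice `s(t) := i.insertNth t q`, `ε = LatticeModels.dispersion`):
* §1 `dispersion_insertNth` (`ε(s(t)) = (1 − cos t) + ε(q)`), `fD q i t := 2·ε(s(t))`, `fD1 t := 2 sin t`, `fD2 t := 2 cos t`, `fD3 t := −2 sin t`, `hasDerivAt_fD∕fD1∕fD2`,
  continuity, `fD_pos` (`q ∈ BZ d`, `q ≠ 0` ⟹ `0 < fD q i t` for EVERY real `t`), periodicity `fD_add_two_pi`.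
* §2 LETTERS on the zone (`t ∈ [−π, π]`, so `s(t) ∈ BZ (d+1)`): `(4∕π²)·‖s(t)‖² ≤ fD q i t` (Jordan), `|fD1 t| ≤ 2‖s(t)‖`, `|fD2 t| ≤ 2`, `|fD3 t| ≤ 2`, `0 < ‖s(t)‖ ≤ π`.
* §3 THE GRADED RECIPROCAL LETTERS: with `rc_k` of `FP/SliceReciprocalChain` at `f := fD q i`:  **`abs_rcD0∕1∕2∕3_le`** —
  `|rc0| ≤ (π²∕4)∕‖s‖²`, `|rc1| ≤ (2(π²∕4)²)∕‖s‖³`, `|rc2| ≤ (8(π²∕4)³ + 2(π²∕4)²)∕‖s‖⁴`, `|rc3| ≤ (48(π²∕4)⁴ + 24(π²∕4)³ + 2π(π²∕4)²)∕‖s‖⁵` — the `z`-letters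
  `c∕r^{2+j}` of `FP/SliceLeibnizChain.norm_ss*_le_pc` for the factor `(2ε)⁻¹` of `B = −P·maxwellMat(W−1)·(2ε)⁻¹` (row H2-P-B), and the `HasDerivAt` chain
  `hasDerivAt_rcD0∕1∕2` on all of `ℝ`.
Provenance: G-an2-4 swarm leaf prover 05, gen 34 (prover-b2b-balaban-gan24-formalise-leaf-05-g34-0), cross-lane on road FP (row H2-P-B claim l.20249), 2026-08-20.
-/

noncomputable section

namespace Summit.QuantumFields.BalabanUV.Beta.FP.DispersionSliceChain

open Real Filter Finset
open scoped BigOperators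
open Literature.MathematicalPhysics.QuantumFieldTheory.Balaban1983to89
open Literature.Probability.LatticeModels (dispersion dispersion_nonneg mul_norm_sq_le_dispersion dispersion_pos_of_mem_brillouin)
open B4ContourShift (BZ)
open Summit.QuantumFields.BalabanUV.Beta.FP.PerfectPropagatorBound (mem_brillouin_of_mem_BZ)
open Summit.QuantumFields.BalabanUV.Beta.FP.SliceReciprocalChain

variable {d : ℕ}

/-! ## §1 The slice of `2ε` and its derivatives -/

/-- [folklore] `ε(i.insertNth t q) = (1 − cos t) + ε(q)`. -/
theorem dispersion_insertNth (i : Fin (d + 1)) (t : ℝ) (q : Fin d → ℝ) :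
    dispersion (i.insertNth t q) = (1 - Real.cos t) + dispersion q := by
  unfold dispersion
  rw [Fin.sum_univ_succAbove _ i, Fin.insertNth_apply_same]
  congr 1
  exact Finset.sum_congr rfl fun a _ => by rw [Fin.insertNth_apply_succAbove]

/-- [our object] `fD q i t := 2·ε(i.insertNth t q)` (= `‖p̂(s(t))‖² = Σ_a ‖e^{i s_a} − 1‖²`). -/
def fD (q : Fin d → ℝ) (i : Fin (d + 1)) (t : ℝ) : ℝ := 2 * dispersion (i.insertNth t q)
/-- [our object] `fD1 t := 2 sin t`. -/
def fD1 (t : ℝ) : ℝ := 2 * Real.sin t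
/-- [our object] `fD2 t := 2 cos t`. -/
def fD2 (t : ℝ) : ℝ := 2 * Real.cos t
/-- [our object] `fD3 t := −2 sin t`. -/
def fD3 (t : ℝ) : ℝ := -(2 * Real.sin t)

/-- [folklore] closed form `fD q i t = (2 − 2cos t) + 2ε(q)`. -/
theorem fD_eq (q : Fin d → ℝ) (i : Fin (d + 1)) (t : ℝ) : fD q i t = (2 - 2 * Real.cos t) + 2 * dispersion q := by
  unfold fD; rw [dispersion_insertNth]; ring

/-- [folklore] `fD′ = fD1`. -/
theorem hasDerivAt_fD (q : Fin d → ℝ) (i : Fin (d + 1)) (t : ℝ) : HasDerivAt (fD q i) (fD1 t) t := by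
  have e : fD q i = fun t => (2 - 2 * Real.cos t) + 2 * dispersion q := funext fun t => fD_eq q i t
  rw [e]; unfold fD1
  have h := (((Real.hasDerivAt_cos t).const_mul 2).const_sub 2).add_const (2 * dispersion q)
  exact h.congr_deriv (by ring)

/-- [folklore] `fD1′ = fD2`. -/
theorem hasDerivAt_fD1 (t : ℝ) : HasDerivAt fD1 (fD2 t) t := by
  unfold fD1 fD2
  exact (Real.hasDerivAt_sin t).const_mul 2

/-- [folklore] `fD2′ = fD3`. -/
theorem hasDerivAt_fD2 (t : ℝ) : HasDerivAt fD2 (fD3 t) t := by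
  unfold fD2 fD3
  have h := (Real.hasDerivAt_cos t).const_mul 2
  exact h.congr_deriv (by ring)

/-- [folklore] `2π`-periodicity of the slice function in `t`. -/
theorem fD_add_two_pi (q : Fin d → ℝ) (i : Fin (d + 1)) (t : ℝ) : fD q i (t + 2 * Real.pi) = fD q i t := by
  rw [fD_eq, fD_eq, Real.cos_add_two_pi]

/-- [folklore] `fD` is continuous in `t`. -/
theorem continuous_fD (q : Fin d → ℝ) (i : Fin (d + 1)) : Continuous (fD q i) := by
  have e : fD q i = fun t => (2 - 2 * Real.cos t) + 2 * dispersion q := funext fun t => fD_eq q i t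
  rw [e]; fun_prop

/-- [folklore] **OFF THE ORIGIN THE SLICE NEVER VANISHES**: `q ∈ BZ d`, `q ≠ 0` ⟹ `0 < 2ε(q) ≤ fD q i t` for every real `t`. -/
theorem fD_pos {q : Fin d → ℝ} (hq : q ∈ BZ d) (hq0 : q ≠ 0) (i : Fin (d + 1)) (t : ℝ) : 0 < fD q i t := by
  rw [fD_eq]
  have h1 : 0 ≤ 2 - 2 * Real.cos t := by linarith [Real.cos_le_one t]
  have h2 : 0 < dispersion q := dispersion_pos_of_mem_brillouin (mem_brillouin_of_mem_BZ hq) hq0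
  linarith

/-! ## §2 Letters on the zone -/

/-- [folklore] the slice point lies in the zone when `t ∈ [−π, π]` and `q ∈ BZ d`. -/
theorem insertNth_mem_BZ (i : Fin (d + 1)) {t : ℝ} (ht : t ∈ Set.Icc (-Real.pi) Real.pi) {q : Fin d → ℝ} (hq : q ∈ BZ d) :
    (i.insertNth t q : Fin (d + 1) → ℝ) ∈ BZ (d + 1) := by
  constructor
  · intro μ
    refine Fin.succAboveCases i ?_ (fun a => ?_) μ
    · rw [Fin.insertNth_apply_same]; exact ht.1
    · rw [Fin.insertNth_apply_succAbove]; exact hq.1 a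
  · intro μ
    refine Fin.succAboveCases i ?_ (fun a => ?_) μ
    · rw [Fin.insertNth_apply_same]; exact ht.2
    · rw [Fin.insertNth_apply_succAbove]; exact hq.2 a

/-- [folklore] JORDAN: on the zone `(4∕π²)·‖s(t)‖² ≤ fD q i t`. -/
theorem norm_sq_le_fD (i : Fin (d + 1)) {t : ℝ} (ht : t ∈ Set.Icc (-Real.pi) Real.pi) {q : Fin d → ℝ} (hq : q ∈ BZ d) :
    4 / Real.pi ^ 2 * ‖(i.insertNth t q : Fin (d + 1) → ℝ)‖ ^ 2 ≤ fD q i t := by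
  have h := mul_norm_sq_le_dispersion (mem_brillouin_of_mem_BZ (insertNth_mem_BZ i ht hq))
  unfold fD
  have : 4 / Real.pi ^ 2 * ‖(i.insertNth t q : Fin (d + 1) → ℝ)‖ ^ 2 = 2 * (2 / Real.pi ^ 2 * ‖(i.insertNth t q : Fin (d + 1) → ℝ)‖ ^ 2) := by ring
  rw [this]; linarith

/-- [folklore] `|fD1 t| ≤ 2‖s(t)‖` (`|sin t| ≤ |t| = |s_i| ≤ ‖s‖`). -/
theorem abs_fD1_le (i : Fin (d + 1)) (t : ℝ) (q : Fin d → ℝ) : |fD1 t| ≤ 2 * ‖(i.insertNth t q : Fin (d + 1) → ℝ)‖ := by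
  unfold fD1
  rw [abs_mul, abs_two]
  have h1 : |Real.sin t| ≤ |t| := Real.abs_sin_le_abs
  have h2 : |t| ≤ ‖(i.insertNth t q : Fin (d + 1) → ℝ)‖ := by
    have := norm_le_pi_norm (i.insertNth t q : Fin (d + 1) → ℝ) i
    rw [Fin.insertNth_apply_same, Real.norm_eq_abs] at this
    exact this
  linarith

/-- [folklore] `|fD2 t| ≤ 2`. -/
theorem abs_fD2_le (t : ℝ) : |fD2 t| ≤ 2 := by
  unfold fD2; rw [abs_mul, abs_two]; have := Real.abs_cos_le_one t; linarith

/-- [folklore] `|fD3 t| ≤ 2`. -/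
theorem abs_fD3_le (t : ℝ) : |fD3 t| ≤ 2 := by
  unfold fD3; rw [abs_neg, abs_mul, abs_two]; have := Real.abs_sin_le_one t; linarith

/-- [folklore] on the zone `‖s(t)‖ ≤ π`. -/
theorem norm_insertNth_le_pi (i : Fin (d + 1)) {t : ℝ} (ht : t ∈ Set.Icc (-Real.pi) Real.pi) {q : Fin d → ℝ} (hq : q ∈ BZ d) :
    ‖(i.insertNth t q : Fin (d + 1) → ℝ)‖ ≤ Real.pi := by
  have hs := insertNth_mem_BZ i ht hq
  refine (pi_norm_le_iff_of_nonneg Real.pi_pos.le).mpr fun μ => ?_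
  rw [Real.norm_eq_abs, abs_le]
  exact ⟨hs.1 μ, hs.2 μ⟩

/-- [folklore] `q ≠ 0` ⟹ `s(t) ≠ 0`, so `0 < ‖s(t)‖`. -/
theorem norm_insertNth_pos (i : Fin (d + 1)) (t : ℝ) {q : Fin d → ℝ} (hq0 : q ≠ 0) : 0 < ‖(i.insertNth t q : Fin (d + 1) → ℝ)‖ := by
  refine norm_pos_iff.mpr fun h => hq0 ?_
  funext a
  have := congrArg (fun s => s (i.succAbove a)) h
  simpa [Fin.insertNth_apply_succAbove] using this

/-! ## §3 The graded reciprocal letters and the chain -/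

section Letters

variable (i : Fin (d + 1)) {t : ℝ} (ht : t ∈ Set.Icc (-Real.pi) Real.pi) {q : Fin d → ℝ} (hq : q ∈ BZ d) (hq0 : q ≠ 0)
include ht hq hq0

/-- [our object] `|(2ε)⁻¹| ≤ (π²∕4)∕‖s‖²`. -/
theorem abs_rcD0_le : |rc0 (fD q i) t| ≤ (4 / Real.pi ^ 2)⁻¹ / ‖(i.insertNth t q : Fin (d + 1) → ℝ)‖ ^ 2 :=
  abs_rc0_le_pc (norm_insertNth_pos i t hq0) (by positivity)
    ((abs_of_pos (fD_pos hq hq0 i t)).symm ▸ norm_sq_le_fD i ht hq)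

/-- [our object] `|((2ε)⁻¹)′| ≤ (2∕(4∕π²)²)∕‖s‖³`. -/
theorem abs_rcD1_le : |rc1 (fD q i) fD1 t| ≤ (2 / (4 / Real.pi ^ 2) ^ 2) / ‖(i.insertNth t q : Fin (d + 1) → ℝ)‖ ^ 3 :=
  abs_rc1_le_pc (norm_insertNth_pos i t hq0) (by positivity)
    ((abs_of_pos (fD_pos hq hq0 i t)).symm ▸ norm_sq_le_fD i ht hq) (abs_fD1_le i t q)

/-- [our object] `|((2ε)⁻¹)″| ≤ (2·2²∕(4∕π²)³ + 2∕(4∕π²)²)∕‖s‖⁴`. -/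
theorem abs_rcD2_le :
    |rc2 (fD q i) fD1 fD2 t| ≤ (2 * 2 ^ 2 / (4 / Real.pi ^ 2) ^ 3 + 2 / (4 / Real.pi ^ 2) ^ 2) / ‖(i.insertNth t q : Fin (d + 1) → ℝ)‖ ^ 4 :=
  abs_rc2_le_pc (norm_insertNth_pos i t hq0) (by positivity)
    ((abs_of_pos (fD_pos hq hq0 i t)).symm ▸ norm_sq_le_fD i ht hq) (abs_fD1_le i t q) (abs_fD2_le t)

/-- [our object] `|((2ε)⁻¹)‴| ≤ (6·2³∕(4∕π²)⁴ + 6·(2·2)∕(4∕π²)³ + 2π∕(4∕π²)²)∕‖s‖⁵`. -/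
theorem abs_rcD3_le :
    |rc3 (fD q i) fD1 fD2 fD3 t|
      ≤ (6 * 2 ^ 3 / (4 / Real.pi ^ 2) ^ 4 + 6 * (2 * 2) / (4 / Real.pi ^ 2) ^ 3 + 2 * Real.pi / (4 / Real.pi ^ 2) ^ 2) / ‖(i.insertNth t q : Fin (d + 1) → ℝ)‖ ^ 5 :=
  abs_rc3_le_pc (norm_insertNth_pos i t hq0) (by positivity) (norm_insertNth_le_pi i ht hq)
    ((abs_of_pos (fD_pos hq hq0 i t)).symm ▸ norm_sq_le_fD i ht hq) (abs_fD1_le i t q) (abs_fD2_le t) (abs_fD3_le t)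

end Letters

/-- [our object] the chain `((2ε)⁻¹)′ = rc1`, for every real `t` when `q ∈ BZ d`, `q ≠ 0`. -/
theorem hasDerivAt_rcD0 (i : Fin (d + 1)) {q : Fin d → ℝ} (hq : q ∈ BZ d) (hq0 : q ≠ 0) (t : ℝ) :
    HasDerivAt (rc0 (fD q i)) (rc1 (fD q i) fD1 t) t :=
  hasDerivAt_rc0 (hasDerivAt_fD q i t) (fD_pos hq hq0 i t).ne'

/-- [our object] `(rc1)′ = rc2`. -/
theorem hasDerivAt_rcD1 (i : Fin (d + 1)) {q : Fin d → ℝ} (hq : q ∈ BZ d) (hq0 : q ≠ 0) (t : ℝ) :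
    HasDerivAt (rc1 (fD q i) fD1) (rc2 (fD q i) fD1 fD2 t) t :=
  hasDerivAt_rc1 (hasDerivAt_fD q i t) (hasDerivAt_fD1 t) (fD_pos hq hq0 i t).ne'

/-- [our object] `(rc2)′ = rc3`. -/
theorem hasDerivAt_rcD2 (i : Fin (d + 1)) {q : Fin d → ℝ} (hq : q ∈ BZ d) (hq0 : q ≠ 0) (t : ℝ) :
    HasDerivAt (rc2 (fD q i) fD1 fD2) (rc3 (fD q i) fD1 fD2 fD3 t) t :=
  hasDerivAt_rc2 (hasDerivAt_fD q i t) (hasDerivAt_fD1 t) (hasDerivAt_fD2 t) (fD_pos hq hq0 i t).ne'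

end Summit.QuantumFields.BalabanUV.Beta.FP.DispersionSliceChain

end
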